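import Summits.QuantumFields.YangMills.Theorems.AlphaInputsT3ACv3Ready
import Summits.QuantumFields.YangMills.Theorems.AlphaInputsT3ACv2Data
import Summits.QuantumFields.Balaban3D.Proofs.FibreClash
import HarnessLib

/-!
# Crux `FluctuationComparisonRegPrL` (stmt-QuantumFields-19935), conjunct (A) `RepAtHeights` — the trivial-history row under the WINDOWED (O) residual
# row R-g18-a (route owner RULING g22-№5): the window COVERS the small-field factor at the trivial history

Fleet seat `ym-ust-19201-p2` (gen 7, named row W-g22-1).  WHAT THIS FILE DOES.  Under R-g18-a the left weight of the lane's (55)-row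
`PinnedStep.Fibre55WinAC k h′` is the WINDOWED pinned weight `wtP_k(proj h′) = 𝟙[win_{k−1}(proj h′)]·M_k(proj h′)` (`wtP_0 = 1`) instead of the bare
pinned mass `M_k(proj h′)` (print's `χ_k(h)` of (40)–(41) p.266 inside «the integral (49)» p.268; cell ym3-torus finding N-g18-2).  At the trivial new
history `h′ = triv_{k+1}` this weight is `𝟙[win_{k−1}(triv_k)]` (`M(triv) = 1`), so the mass-free, window-free trivial row
`T_k[χB_k(triv′)·e^{(41)_k exponent at triv_k}] ≤ᵐ e^{(55)·(58) exponent at triv′}` that conjunct (A) consumes (`…RepAtHeightsWinRow`,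
`…RepAtHeightsTrivRow`) follows from the windowed row EXACTLY WHEN the window of the old history covers the support of the small-field factor
`χB_k(triv′) = 𝟙[all plaquettes ε₁(k)-small]` (`FibreClash.chiB_triv_eq`).  §1 proves this for the lane's AC tower over ANY scales, AC inputs and
window family, with the windowed row stated VERBATIM (the display of R-g18-a at `h′ = triv′`, definition-free) and the covering as the hypothesis
`hsupp : χB_k(triv′)(U) ≠ 0 → wtP_k(triv_k)(U) = 1` (`fibre55Triv_of_windowedRow`).  §2 DISCHARGES the covering for the T³ data with print's (40) windows
`AlphaInputsT3AC.admWindowT3` (`wtP_admWindowT3_triv_eq_one`): `ε₁(k) = θBal(K − k) ≤ 2L²·θBal(K − k + 1) ≤ 2L²·avgWindowFactor(L)·θBal(K − k + 1)`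
(`θBal_le_two_mul_sq_mul_θBal_succ`, `1 ≤ avgWindowFactor`), every `k ≤ K`.  So for the admissible window family NOTHING downstream of the
trivial row changes under R-g18-a.  CONDITIONAL on the row (a hypothesis, never asserted); [folklore] bookkeeping, nothing of [Balaban1985UV3] is claimed.
[cite: Balaban1985UV3, (7) p.257, (40)-(41) p.266, (49) p.268, (55) p.269, (58) p.270]

References: T. Bałaban, Commun. Math. Phys. 102 (1985) 255–275 [Balaban1985UV3] ((7) p.257, (40)–(41) p.266, (47)–(49) pp.267–268, (55)–(58)
pp.269–270, p.272 L32–33).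
-/

set_option autoImplicit false

noncomputable section

namespace Summit.QuantumFields.YangMills.Theorems

open MeasureTheory Filter
open Literature.MathematicalPhysics.QuantumFieldTheory.Balaban1983to89
open Literature.MathematicalPhysics.QuantumFieldTheory.Balaban1983to89.AveragingRT (rnTransport)
open Literature.MathematicalPhysics.QuantumFieldTheory.Balaban1983to89.T3ContinuumYM3Torus
open Literature.MathematicalPhysics.QuantumFieldTheory.Balaban1983to89.T3UnitScaleTilt (θBal)
open Literature.MathematicalPhysics.QuantumFieldTheory.Balaban1983to89.T3AlphaInputsAC
open Literature.MathematicalPhysics.QuantumFieldTheory.Balaban1983to89.B10Eq38TorusDomains (plaqsIn)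
open Literature.MathematicalPhysics.QuantumFieldTheory.Balaban1985CMP102
open Literature.MathematicalPhysics.QuantumFieldTheory.Balaban1985CMP102.Setting
open Summit.QuantumFields.Balaban3D.Carriers
open Summit.QuantumFields.Balaban3D.Proofs.Primitives
open Summit.QuantumFields.Balaban3D.Proofs.Inputs (LaneConsts)
open Summit.QuantumFields.Balaban3D.Proofs.TowerAC
open Summit.QuantumFields.Balaban3D.Proofs.StandardAC
open Summit.QuantumFields.Balaban3D.Proofs.InputsAC
open Summit.QuantumFields.Balaban3D.Proofs.Bound55Masses (chiB chiB_nonneg)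
open Summit.QuantumFields.Balaban3D.Proofs.MassesPAC

/-! ## §1 The windowed (55)-row at the trivial new history gives the mass-free trivial row when the window covers `χB_k(triv′)` (lane-generic) -/

section Generic

variable {L : ℕ} (𝔎 : LaneConsts L) {S : Scales L} {G : Type} [GaugeGroup G] [MeasurableSpace G] [HaarData G]
  {E : Type} [NormedAddCommGroup E] [NormedSpace ℂ E]
  (X : ExternalInputsAC S G) (𝔖 : ∀ k, StepSeries S G E (nblkOf S 𝔎.carrier k) k)
  (win : (k : ℕ) → Hist S.P (k + 1) → Set (GaugeField S.P (k + 1) G))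

/-- **THE WINDOWED (55)-ROW AT `h′ = triv′` ⇒ THE MASS-FREE TRIVIAL-HISTORY ROW, WHEN THE WINDOW COVERS `χB_k(triv′)`**: for the lane's AC tower over any
scales, AC inputs and ANY window family `win`, at a step `k ≤ m + K`: if «the integral (49)» of the trivial new history with the WINDOWED pinned weight
`wtP_k(triv_k)` on the left (R-g18-a's display of `PinnedStep.Fibre55WinAC k triv′`, stated verbatim) is `dV`-a.e. below
`𝟙[win_k(triv′)]·M_{k+1}(triv′)·e^{(55)·(58) exponent at triv′}`, and the windowed weight is `1` wherever the small-field factor `χB_k(triv′)` is non-zero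
(`hsupp`; automatic at `k = 0`, `wtP_0 = 1`), then `T_k[χB_k(triv′)·e^{(41)_k exponent at triv_k}] ≤ᵐ e^{(55)·(58) exponent at triv′}` —
`w_k(triv′) = 1` (`Carriers.stepWeight_triv`), `M_{k+1}(triv′) = 1` (`MassesPAC.massRecP_triv`), `𝟙[window] ≤ 1` on the right.
[cite: Balaban1985UV3, (40)-(41) p.266, (49) p.268, (55) p.269 and p.272 L32-33] -/
theorem LogComparisonRepAtHeights.fibre55Triv_of_windowedRow (k : ℕ) (hk : k ≤ S.P.m + S.P.K)
    (hrow : (rnTransport (X.av k).avg (fun U =>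
        stepWeight 𝔎.carrier.M₁ (rcolOf S 𝔎.carrier) (eps1Of S 𝔎.carrier) (epsSOf S 𝔎.carrier) k (Hist.triv S.P (k + 1)) U *
          chiB 𝔎.carrier.M₁ (rcolOf S 𝔎.carrier) (eps1Of S 𝔎.carrier) k (Hist.triv S.P (k + 1)) U *
          (PinnedStep.wtP 𝔎 X win k (Hist.triv S.P (k + 1)).proj U *
            Real.exp (-((towerOfAC 𝔎 X 𝔖).mainT k (Hist.triv S.P (k + 1)).proj U) + (towerOfAC 𝔎 X 𝔖).Pint k (Hist.triv S.P (k + 1)).proj U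
              - (towerOfAC 𝔎 X 𝔖).Ecst k + (towerOfAC 𝔎 X 𝔖).Zterm k (Hist.triv S.P (k + 1)).proj + (towerOfAC 𝔎 X 𝔖).Rm k))))
      ≤ᵐ[fieldMeasure S.P (k + 1) G] fun V =>
        (win k (Hist.triv S.P (k + 1))).indicator (fun _ => (1 : ℝ)) V * PinnedStep.massP 𝔎 X (k + 1) (Hist.triv S.P (k + 1)) V *
          Real.exp (-((towerOfAC 𝔎 X 𝔖).mainT (k + 1) (Hist.triv S.P (k + 1)) V) - (towerOfAC 𝔎 X 𝔖).Ecst k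
            + ((piecesAC 𝔎 X 𝔖 k).logσ₀ + (piecesAC 𝔎 X 𝔖 k).dg * Real.log ((towerOfAC 𝔎 X 𝔖).g k)) * (piecesAC 𝔎 X 𝔖 k).starB (Hist.triv S.P (k + 1))
            + (piecesAC 𝔎 X 𝔖 k).logZU (Hist.triv S.P (k + 1)) V + (piecesAC 𝔎 X 𝔖 k).Pold (Hist.triv S.P (k + 1)) V
            + (towerOfAC 𝔎 X 𝔖).Zterm k ((piecesAC 𝔎 X 𝔖 k).proj (Hist.triv S.P (k + 1))) + (towerOfAC 𝔎 X 𝔖).Rm k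
            + (piecesAC 𝔎 X 𝔖 k).logFl (Hist.triv S.P (k + 1)) V))
    (hsupp : ∀ U : GaugeField S.P k G,
      chiB 𝔎.carrier.M₁ (rcolOf S 𝔎.carrier) (eps1Of S 𝔎.carrier) k (Hist.triv S.P (k + 1)) U ≠ 0 →
        PinnedStep.wtP 𝔎 X win k (Hist.triv S.P k) U = 1) :
    (rnTransport (X.av k).avg (fun U =>
        chiB 𝔎.carrier.M₁ (rcolOf S 𝔎.carrier) (eps1Of S 𝔎.carrier) k (Hist.triv S.P (k + 1)) U *
          Real.exp (-((towerOfAC 𝔎 X 𝔖).mainT k (Hist.triv S.P k) U) + (towerOfAC 𝔎 X 𝔖).Pint k (Hist.triv S.P k) U - (towerOfAC 𝔎 X 𝔖).Ecst k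
            + (towerOfAC 𝔎 X 𝔖).Zterm k (Hist.triv S.P k) + (towerOfAC 𝔎 X 𝔖).Rm k)))
      ≤ᵐ[fieldMeasure S.P (k + 1) G] fun V =>
        Real.exp (-((towerOfAC 𝔎 X 𝔖).mainT (k + 1) (Hist.triv S.P (k + 1)) V) - (towerOfAC 𝔎 X 𝔖).Ecst k
          + ((piecesAC 𝔎 X 𝔖 k).logσ₀ + (piecesAC 𝔎 X 𝔖 k).dg * Real.log ((towerOfAC 𝔎 X 𝔖).g k)) * (piecesAC 𝔎 X 𝔖 k).starB (Hist.triv S.P (k + 1))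
          + (piecesAC 𝔎 X 𝔖 k).logZU (Hist.triv S.P (k + 1)) V + (piecesAC 𝔎 X 𝔖 k).Pold (Hist.triv S.P (k + 1)) V
          + (towerOfAC 𝔎 X 𝔖).Zterm k ((piecesAC 𝔎 X 𝔖 k).proj (Hist.triv S.P (k + 1))) + (towerOfAC 𝔎 X 𝔖).Rm k
          + (piecesAC 𝔎 X 𝔖 k).logFl (Hist.triv S.P (k + 1)) V) := by
  -- the left integrand of the windowed row at `triv′` IS the mass-free one: `w_k(triv′) = 1`, and `wtP_k(triv_k) = 1` wherever `χB_k(triv′) ≠ 0`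
  have hL : (fun U => stepWeight 𝔎.carrier.M₁ (rcolOf S 𝔎.carrier) (eps1Of S 𝔎.carrier) (epsSOf S 𝔎.carrier) k (Hist.triv S.P (k + 1)) U *
        chiB 𝔎.carrier.M₁ (rcolOf S 𝔎.carrier) (eps1Of S 𝔎.carrier) k (Hist.triv S.P (k + 1)) U *
        (PinnedStep.wtP 𝔎 X win k (Hist.triv S.P (k + 1)).proj U *
          Real.exp (-((towerOfAC 𝔎 X 𝔖).mainT k (Hist.triv S.P (k + 1)).proj U) + (towerOfAC 𝔎 X 𝔖).Pint k (Hist.triv S.P (k + 1)).proj U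
            - (towerOfAC 𝔎 X 𝔖).Ecst k + (towerOfAC 𝔎 X 𝔖).Zterm k (Hist.triv S.P (k + 1)).proj + (towerOfAC 𝔎 X 𝔖).Rm k))) =
      fun U => chiB 𝔎.carrier.M₁ (rcolOf S 𝔎.carrier) (eps1Of S 𝔎.carrier) k (Hist.triv S.P (k + 1)) U *
          Real.exp (-((towerOfAC 𝔎 X 𝔖).mainT k (Hist.triv S.P k) U) + (towerOfAC 𝔎 X 𝔖).Pint k (Hist.triv S.P k) U - (towerOfAC 𝔎 X 𝔖).Ecst k
            + (towerOfAC 𝔎 X 𝔖).Zterm k (Hist.triv S.P k) + (towerOfAC 𝔎 X 𝔖).Rm k) := by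
    funext U
    rw [stepWeight_triv _ _ _ _ hk U, Hist.proj_triv, one_mul]
    by_cases hχ : chiB 𝔎.carrier.M₁ (rcolOf S 𝔎.carrier) (eps1Of S 𝔎.carrier) k (Hist.triv S.P (k + 1)) U = 0
    · rw [hχ, zero_mul, zero_mul]
    · rw [hsupp U hχ, one_mul]
  -- the new pinned mass at `triv′` is `1` and the window indicator on the right is `≤ 1`
  have h1 : ∀ V : GaugeField S.P (k + 1) G, PinnedStep.massP 𝔎 X (k + 1) (Hist.triv S.P (k + 1)) V = 1 :=
    fun V => massRecP_triv _ _ _ _ _ (k + 1) V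
  rw [hL] at hrow
  filter_upwards [hrow] with V hV
  refine hV.trans ?_
  rw [h1 V, mul_one]
  have hi1 : (win k (Hist.triv S.P (k + 1))).indicator (fun _ => (1 : ℝ)) V ≤ 1 := Set.indicator_le_self' (fun _ _ => zero_le_one) V
  exact mul_le_of_le_one_left (Real.exp_pos _).le hi1

/-- At `k = 0` the covering hypothesis is empty: `wtP_0 ≡ 1` ((41)₀ = (1) p.256 carries no characteristic function). [cite: Balaban1985UV3, (1) p.256 + (41) p.266] -/
theorem LogComparisonRepAtHeights.wtP_zero_triv_eq_one (U : GaugeField S.P 0 G)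
    (_hU : chiB 𝔎.carrier.M₁ (rcolOf S 𝔎.carrier) (eps1Of S 𝔎.carrier) 0 (Hist.triv S.P 1) U ≠ 0) :
    PinnedStep.wtP 𝔎 X win 0 (Hist.triv S.P 0) U = 1 := rfl

end Generic

/-! ## §2 The T³ data: print's (40) window of the old trivial history COVERS the small-field factor `χB_k(triv′)` -/

section T3

variable {F : T3Family} {𝔠 : AlphaConsts F.L (suGroupModel 2).N} {γ : ℝ} {hγ : 0 < γ} (hγ1 : γ ≤ (min 𝔠.gamma0 1) ^ 2) {K : ℕ}

/-- `1 ≤ avgWindowFactor L = L² + 6·(5L)²` for `L ≥ 1`. [folklore] -/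
theorem AlphaInputsT3AC.one_le_avgWindowFactor (F : T3Family) : 1 ≤ avgWindowFactor F.L := by
  unfold avgWindowFactor
  have hL : (1 : ℝ) ≤ F.L := by exact_mod_cast (le_of_lt F.hL.2)
  have h5 : (0 : ℝ) ≤ (((3 + 2) * F.L : ℕ) : ℝ) ^ 2 := sq_nonneg _
  nlinarith

/-- **THE LANE'S SMALL-FIELD THRESHOLD SITS INSIDE PRINT'S (40) WINDOW ONE LEVEL UP**, at the T³ scales of run `K`, every `k ≤ K`:
`ε₁(k) = g_kp(g_k) = θBal(K − k) ≤ 2L²·avgWindowFactor(L)·θBal(K − k + 1)` (`AlphaInputsT3AC.PkgAt.eps1_eq`'s dictionary, package-free;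
`θBal_le_two_mul_sq_mul_θBal_succ`; `1 ≤ avgWindowFactor`). [cite: Balaban1985UV3, (7) p.257 and (40) p.266] -/
theorem AlphaInputsT3AC.eps1Of_le_admWindow_radius (k : ℕ) (hk : k ≤ K) :
    eps1Of (T3Scales F γ hγ (hγ1.trans (sq_min_one_le _ 𝔠.gamma0_pos)) K) 𝔠.lane.carrier k ≤
      2 * (F.L : ℝ) ^ 2 * avgWindowFactor F.L * θBal F.L γ 𝔠.b₀ 𝔠.p₀ (K - k + 1) := by
  have hγ1' : γ ≤ 1 := hγ1.trans (sq_min_one_le _ 𝔠.gamma0_pos)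
  have hε : eps1Of (T3Scales F γ hγ hγ1' K) 𝔠.lane.carrier k = θBal F.L γ 𝔠.b₀ 𝔠.p₀ (K - k) := by
    show (T3Scales F γ hγ hγ1' K).gk k * B10.pFun 𝔠.b₀ 𝔠.p₀ ((T3Scales F γ hγ hγ1' K).gk k) = _
    rw [T3Scales_gk_eq F γ hγ hγ1' K k hk]
    rfl
  have hmono := θBal_le_two_mul_sq_mul_θBal_succ (le_of_lt F.hL.2) hγ hγ1' 𝔠.b₀_pos 𝔠.p₀_pos.le (K - k)
  have hθ : 0 ≤ θBal F.L γ 𝔠.b₀ 𝔠.p₀ (K - k + 1) :=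
    (T3MinimiserStabilityReduction.θBal_pos (le_of_lt F.hL.2) hγ hγ1' 𝔠.b₀_pos 𝔠.p₀ (K - k + 1)).le
  have hB : 1 ≤ avgWindowFactor F.L := AlphaInputsT3AC.one_le_avgWindowFactor F
  have hL2 : (0 : ℝ) ≤ 2 * (F.L : ℝ) ^ 2 := by positivity
  rw [hε]
  calc θBal F.L γ 𝔠.b₀ 𝔠.p₀ (K - k) ≤ 2 * (F.L : ℝ) ^ 2 * θBal F.L γ 𝔠.b₀ 𝔠.p₀ (K - k + 1) := hmono
    _ = 2 * (F.L : ℝ) ^ 2 * 1 * θBal F.L γ 𝔠.b₀ 𝔠.p₀ (K - k + 1) := by ring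
    _ ≤ 2 * (F.L : ℝ) ^ 2 * avgWindowFactor F.L * θBal F.L γ 𝔠.b₀ 𝔠.p₀ (K - k + 1) :=
        mul_le_mul_of_nonneg_right (mul_le_mul_of_nonneg_left hB hL2) hθ

/-- **PRINT'S (40) WINDOW COVERS THE SMALL-FIELD FACTOR AT THE TRIVIAL HISTORY** — the covering hypothesis `hsupp` of `fibre55Triv_of_windowedRow`
DISCHARGED for the T³ data with the window family `AlphaInputsT3AC.admWindowT3` (any AC external inputs `X` over the T³ scales of run `K`; every
`k ≤ K`): where `χB_k(triv_{k+1})(U) ≠ 0` — all level-`k` plaquettes of `U` are `ε₁(k)`-small (`FibreClash.chiB_triv_eq`) — the windowed pinned weight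
`wtP_k(triv_k)(U) = 𝟙[admWindowT3 K (k−1) triv_k](U)·M_k(triv_k)(U)` equals `1`: `M(triv) = 1` (`massRecP_triv`), and `U` lies in the (40) window of
radius `2L²·avgWindowFactor(L)·θBal(K − k + 1) ≥ ε₁(k)` (`eps1Of_le_admWindow_radius`); at `k = 0`, `wtP_0 = 1`.
[cite: Balaban1985UV3, (7) p.257, (40)-(41) p.266 and (49) p.268] -/
theorem AlphaInputsT3AC.wtP_admWindowT3_triv_eq_one
    (X : ExternalInputsAC (T3Scales F γ hγ (hγ1.trans (sq_min_one_le _ 𝔠.gamma0_pos)) K) (Matrix.specialUnitaryGroup (Fin 2) ℂ))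
    (k : ℕ) (hk : k ≤ K) (U : GaugeField (F.P K) k (Matrix.specialUnitaryGroup (Fin 2) ℂ))
    (hU : chiB 𝔠.lane.carrier.M₁ (rcolOf (T3Scales F γ hγ (hγ1.trans (sq_min_one_le _ 𝔠.gamma0_pos)) K) 𝔠.lane.carrier)
      (eps1Of (T3Scales F γ hγ (hγ1.trans (sq_min_one_le _ 𝔠.gamma0_pos)) K) 𝔠.lane.carrier) k (Hist.triv (F.P K) (k + 1)) U ≠ 0) :
    PinnedStep.wtP 𝔠.lane X (AlphaInputsT3AC.admWindowT3 F 𝔠 γ hγ hγ1 K) k (Hist.triv (F.P K) k) U = 1 := by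
  have hγ1' : γ ≤ 1 := hγ1.trans (sq_min_one_le _ 𝔠.gamma0_pos)
  cases k with
  | zero => rfl
  | succ j =>
    -- all level-`(j+1)` plaquettes of `U` are `ε₁(j+1)`-small
    classical
    have hχ : chiB 𝔠.lane.carrier.M₁ (rcolOf (T3Scales F γ hγ hγ1' K) 𝔠.lane.carrier)
        (eps1Of (T3Scales F γ hγ hγ1' K) 𝔠.lane.carrier) (j + 1) (Hist.triv (F.P K) (j + 1 + 1)) U =
          if PlaqSmall (eps1Of (T3Scales F γ hγ hγ1' K) 𝔠.lane.carrier (j + 1)) U then 1 else 0 :=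
      Summit.QuantumFields.Balaban3D.Proofs.FibreClash.chiB_triv_eq (S := T3Scales F γ hγ hγ1' K) (j + 1) 𝔠.lane.carrier.M₁ (rcolOf (T3Scales F γ hγ hγ1' K) 𝔠.lane.carrier)
        (eps1Of (T3Scales F γ hγ hγ1' K) 𝔠.lane.carrier) U
    have hsmall : PlaqSmall (eps1Of (T3Scales F γ hγ hγ1' K) 𝔠.lane.carrier (j + 1)) U := by
      by_contra hs
      exact hU (by rw [hχ, if_neg hs])
    -- so `U` is in the (40) window of the old trivial history
    have hrad := AlphaInputsT3AC.eps1Of_le_admWindow_radius (F := F) (𝔠 := 𝔠) (hγ := hγ) hγ1 (K := K) (j + 1) hk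
    have hKj : K - (j + 1) + 1 = K - j := by omega
    rw [hKj] at hrad
    have hmem : U ∈ AlphaInputsT3AC.admWindowT3 F 𝔠 γ hγ hγ1 K j (Hist.triv (F.P K) (j + 1)) := by
      show PlaqSmallOn _ _ U
      intro p _
      exact (hsmall p).trans_le hrad
    -- and the old pinned mass at the trivial history is `1` (the `show` re-letters `(T3Scales …).P` as `F.P K` for the rewrite)
    rw [PinnedStep.wtP_succ]
    show (AlphaInputsT3AC.admWindowT3 F 𝔠 γ hγ hγ1 K j (Hist.triv (F.P K) (j + 1))).indicator (fun _ => (1 : ℝ)) U *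
        PinnedStep.massP 𝔠.lane X (j + 1) (Hist.triv (F.P K) (j + 1)) U = 1
    rw [Set.indicator_of_mem hmem, one_mul]
    exact massRecP_triv _ _ _ _ _ (j + 1) U

end T3

end Summit.QuantumFields.YangMills.Theorems

end
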